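import Summits.ResolutionOfSingularities.ResolutionOfSingularities.Theorems.WeightedInvariantTieFiniteTopology
import Summits.ResolutionOfSingularities.ResolutionOfSingularities.Theorems.WeightedInvariantTieFiniteCatch
import Summits.ResolutionOfSingularities.ResolutionOfSingularities.Theorems.WeightedInvariantTieFiniteGeneric
import HarnessLib

/-!
# Finiteness of the tie points, in-chart step, RING-LEVEL PACKAGING: on an affine chart along the curve, the tie primes over the
# curve are finitely many (door `HypersurfaceCentreConstruction`, stmt-ResolutionOfSingularities-19897, route `WeightedInvariant`, P3 rung
# `KeyRungGrLE 3 p`, clause (c8)≤3,p for the letter `τ`)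

[OURS · L1 W4.3 · cell `res-hironaka`, HUMAN RULING D-0089] Helper file `--supports stmt-ResolutionOfSingularities-19897` (line
`local-engine` of res-L1-w43-plan-1, RULING gen 11 #5 «Chevalley + generic drop» / gen 12 #10 variant (V-AQS), spec
`L/res-type-047/D2-INCHART-SPEC-v2.md` §1 (FIN)).  SETTING: `A` Noetherian (the affine ring `A_h` of the chart), `P` a prime — the generic
point `η` of the curve — with `A_P` regular of dimension `2` and every prime strictly above `P` maximal; `U = (y′, x′) ⊆ P` with
`(U/1; (r, q); r n)` the lex-maximal admissible weighted centre germ of `(f/1) ⊆ A_P`, `ord_{A_P} f = n ≥ 2`; the global move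
`B = extReesAlgebra (weightedMonomialIdeal U (r, q))` with `f = (t⁻¹)^{rn} G`, `t⁻¹ ∤ G`, coefficients of `G` contracted at `P`; and the
three Chevalley inputs of res-D-brk-1's door package (`…GlobalMoveChevalley`, p541259): (F) `algebraMap A B` of finite presentation,
(WP) primes `∋ t⁻¹` contract into `V(U) ⊆ V(P)`, (W) the no-drop loci `{t⁻¹ ∈ 𝔫, X ∉ 𝔫, G/1 ∈ 𝔪_𝔫ⁿ}` are constructible.

MAIN (`TieFinite.finite_tiePrimes`): the set of primes `𝔮 ⊋ P` at which `A_𝔮` is regular, `f/1 ∈ 𝔪_𝔮ⁿ ∖ 𝔪_𝔮ⁿ⁺¹` is a TIE POSITION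
(`Iota3.IsTiePosition`, res-type-092) with top-stratum prime `P A_𝔮` and `U/1` independent in `𝔪_𝔮/𝔪_𝔮²`, is FINITE.  Proof = the
Chevalley form `TieFinite.finite_image_comap_of_isConstructible` (p536684) applied to `W = W₀ ∪ W₁`, `Wᵢ = {t⁻¹ ∈ 𝔫, uᵢt^{wᵢ} ∉ 𝔫, G/1 ∈ 𝔪_𝔫ⁿ}`:
(WP) by hypothesis, (Wη) = `TieFinite.not_mem_pow_of_over_generic` (p547682, res-type-098's AQS drop at `A_P` through res-D-brk-1's
dictionary), (Wtie) = `TieFinite.exists_noDrop_prime_of_isTiePosition` (p546889) after transporting the lex-maximal datum from `A_P` to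
`(A_𝔮)_{P A_𝔮}` (`isLexMax_localization_localization`, Mathlib's `localizationLocalizationAtPrimeIsoLocalization` + 092's
`LexMaxCentre.map_ringEquiv`).

[OURS] Replaces the role of NO printed item; NOT a statement of the manuscript under review [claim: Hironaka2017, status:
under-review].  AI work, weaker than expert review.  Def-free.

## References

* A. Grothendieck, EGA IV₁ 1.8.4 (Chevalley) — Mathlib `PrimeSpectrum.isConstructible_comap_image`.
* D. Abramovich, M. H. Quek, B. Schober, arXiv:2507.01232 (v3, 2026), Thm 1.3 (3), Thm 3.5, §5. [AbramovichQuekSchober2025]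
-/

noncomputable section

set_option linter.dupNamespace false -- mandated namespace `Summit.<Summit>.<Problem>` of this single-conjunct summit

open IsLocalRing Literature.AlgebraicGeometry.Resolution LaurentPolynomial Topology
open Summit.ResolutionOfSingularities.ResolutionOfSingularities.Theorems

namespace Summit.ResolutionOfSingularities.ResolutionOfSingularities.Cruxes.HypersurfaceCentreConstruction.LocalEngine

namespace TieFinite

variable {A : Type} [CommRing A]

/-! ## The lex-maximal datum travels from `A_P` to `(A_𝔮)_{P A_𝔮}` -/

/-- **Transport of the lex-maximal datum along `A_P ≃ (A_𝔮)_{P₀}`** (`P₀` a prime of `A_𝔮` over `P`; Mathlib's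
`localizationLocalizationAtPrimeIsoLocalization` and res-type-092's `LexMaxCentre.map_ringEquiv`). [folklore] -/
theorem isLexMax_localization_localization (𝔮 : Ideal A) [𝔮.IsPrime] (P₀ : Ideal (Localization.AtPrime 𝔮)) [P₀.IsPrime]
    (P : Ideal A) [P.IsPrime] (hP₀ : P₀.comap (algebraMap A (Localization.AtPrime 𝔮)) = P)
    {f : A} {U : Fin 2 → A} {w : Fin 2 → ℕ} {ℓ : ℕ}
    (hlex : IsLexMaxWeightedCentreGerm (Localization.AtPrime P) (Ideal.span {algebraMap A (Localization.AtPrime P) f})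
      (fun i => algebraMap A (Localization.AtPrime P) (U i)) w ℓ) :
    IsLexMaxWeightedCentreGerm (Localization.AtPrime P₀)
      (Ideal.span {algebraMap (Localization.AtPrime 𝔮) (Localization.AtPrime P₀) (algebraMap A (Localization.AtPrime 𝔮) f)})
      (fun i => algebraMap (Localization.AtPrime 𝔮) (Localization.AtPrime P₀) (algebraMap A (Localization.AtPrime 𝔮) (U i)))
      w ℓ := by
  subst hP₀
  have h := LexMaxCentre.map_ringEquiv hlex
    (IsLocalization.localizationLocalizationAtPrimeIsoLocalization 𝔮.primeCompl P₀).toRingEquiv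
  have he : ∀ a : A, (IsLocalization.localizationLocalizationAtPrimeIsoLocalization 𝔮.primeCompl P₀).toRingEquiv
      (algebraMap A _ a) = algebraMap (Localization.AtPrime 𝔮) (Localization.AtPrime P₀) (algebraMap A _ a) := fun a => by
    rw [AlgEquiv.coe_ringEquiv, AlgEquiv.commutes,
      IsScalarTower.algebraMap_apply A (Localization.AtPrime 𝔮) (Localization.AtPrime P₀)]
  rw [Ideal.map_span, Set.image_singleton, RingEquiv.coe_toRingHom, he] at h
  simp only [he] at h
  exact h

/-! ## The chart generators lie in the vertex ideal -/

/-- `uᵢ t^{wᵢ} ∈ vertexIdeal` for a positive weight. [cite: Wlodarczyk2022, Def. 2.3.5] -/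
theorem uT_mem_vertexIdeal {m : ℕ} (U : Fin m → A) (W : Fin m → ℕ) {i : Fin m} (hi : 0 < W i) :
    LocalGameEFTPointMove.uT U W i ∈ extReesAlgebra.vertexIdeal (weightedMonomialIdeal U W) :=
  Ideal.subset_span ⟨W i, hi, U i, mem_weightedMonomialIdeal_self U W i, rfl⟩

/-! ## MAIN: finitely many tie primes over the curve in the chart -/

/-- **FINITELY MANY TIE PRIMES OVER THE CURVE (in-chart step of the finiteness of the tie points, ring level).**  See the module
docstring for the data.  The set of primes `𝔮 ⊋ P` with `A_𝔮` regular, `f/1 ∈ 𝔪_𝔮ⁿ ∖ 𝔪_𝔮ⁿ⁺¹` a tie position whose top-stratum prime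
is `P A_𝔮`, and `U/1` independent in `𝔪_𝔮/𝔪_𝔮²`, is finite. [cite: AbramovichQuekSchober2025, Thm 1.3 (3), Thm 3.5] -/
theorem finite_tiePrimes [IsNoetherianRing A] (P : Ideal A) [P.IsPrime] [IsRegularLocalRing (Localization.AtPrime P)]
    (hdimP : ringKrullDim (Localization.AtPrime P) = 2) (hmax : ∀ 𝔮 : Ideal A, 𝔮.IsPrime → P < 𝔮 → 𝔮.IsMaximal)
    {f : A} {n : ℕ} (hn : 2 ≤ n) (hord : adicOrder (algebraMap A (Localization.AtPrime P) f) = (n : ℕ∞))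
    (U : Fin 2 → A) {r q : ℕ} (hUP : ∀ i, U i ∈ P)
    (hlex : IsLexMaxWeightedCentreGerm (Localization.AtPrime P) (Ideal.span {algebraMap A (Localization.AtPrime P) f})
      (fun i => algebraMap A (Localization.AtPrime P) (U i)) ![r, q] (r * n))
    {G : extReesAlgebra (weightedMonomialIdeal U ![r, q])}
    (hfg : algebraMap A (extReesAlgebra (weightedMonomialIdeal U ![r, q])) f =
      extReesAlgebra.tInv (weightedMonomialIdeal U ![r, q]) ^ (r * n) * G)
    (hG : ¬ extReesAlgebra.tInv (weightedMonomialIdeal U ![r, q]) ∣ G)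
    (hcontr : ∀ m : ℕ, algebraMap A (Localization.AtPrime P) ((G : A[T;T⁻¹]).coeff ((m : ℤ) - 1)) ∈
        weightedMonomialIdeal (fun i => algebraMap A (Localization.AtPrime P) (U i)) ![r, q] m →
      (G : A[T;T⁻¹]).coeff ((m : ℤ) - 1) ∈ weightedMonomialIdeal U ![r, q] m)
    (hF : (algebraMap A (extReesAlgebra (weightedMonomialIdeal U ![r, q]))).FinitePresentation)
    (hWP : ∀ 𝔫 : Ideal (extReesAlgebra (weightedMonomialIdeal U ![r, q])), extReesAlgebra.tInv _ ∈ 𝔫 →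
      Ideal.span (Set.range U) ≤ 𝔫.comap (algebraMap A _))
    (hWc : ∀ (t X G' : extReesAlgebra (weightedMonomialIdeal U ![r, q])) (m : ℕ),
      IsConstructible {𝔫 : PrimeSpectrum (extReesAlgebra (weightedMonomialIdeal U ![r, q])) |
        t ∈ 𝔫.asIdeal ∧ X ∉ 𝔫.asIdeal ∧
          algebraMap _ (Localization.AtPrime 𝔫.asIdeal) G' ∈ maximalIdeal (Localization.AtPrime 𝔫.asIdeal) ^ m})
    (hVU : ∀ 𝔮 : Ideal A, 𝔮.IsPrime → Ideal.span (Set.range U) ≤ 𝔮 → P ≤ 𝔮) :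
    {𝔮 : PrimeSpectrum A | P < 𝔮.asIdeal ∧ ∃ (_ : IsRegularLocalRing (Localization.AtPrime 𝔮.asIdeal))
      (_ : (P.map (algebraMap A (Localization.AtPrime 𝔮.asIdeal))).IsPrime)
      (hu : ∀ i, algebraMap A (Localization.AtPrime 𝔮.asIdeal) (U i) ∈ maximalIdeal (Localization.AtPrime 𝔮.asIdeal)),
      LinearIndependent (ResidueField (Localization.AtPrime 𝔮.asIdeal)) (fun i =>
        (maximalIdeal (Localization.AtPrime 𝔮.asIdeal)).toCotangent ⟨algebraMap A _ (U i), hu i⟩) ∧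
      Iota3.IsTiePosition (Localization.AtPrime 𝔮.asIdeal) (algebraMap A (Localization.AtPrime 𝔮.asIdeal) f) ∧
      algebraMap A (Localization.AtPrime 𝔮.asIdeal) f ∈ maximalIdeal (Localization.AtPrime 𝔮.asIdeal) ^ n ∧
      algebraMap A (Localization.AtPrime 𝔮.asIdeal) f ∉ maximalIdeal (Localization.AtPrime 𝔮.asIdeal) ^ (n + 1) ∧
      ContactCylinder.topStratumPrime Iota3.iotaOrdEps (Localization.AtPrime 𝔮.asIdeal)
        (algebraMap A (Localization.AtPrime 𝔮.asIdeal) f) = P.map (algebraMap A (Localization.AtPrime 𝔮.asIdeal))}.Finite := by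
  classical
  -- the two no-drop loci `Wᵢ = {t⁻¹ ∈ 𝔫, uᵢ t^{wᵢ} ∉ 𝔫, G/1 ∈ 𝔪_𝔫ⁿ}`
  let Wset : Set (PrimeSpectrum (extReesAlgebra (weightedMonomialIdeal U ![r, q]))) := ⋃ i : Fin 2, {𝔫 | extReesAlgebra.tInv (weightedMonomialIdeal U ![r, q]) ∈ 𝔫.asIdeal ∧
    LocalGameEFTPointMove.uT U ![r, q] i ∉ 𝔫.asIdeal ∧
      algebraMap _ (Localization.AtPrime 𝔫.asIdeal) G ∈ maximalIdeal (Localization.AtPrime 𝔫.asIdeal) ^ n}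
  have hW : IsConstructible Wset := by
    refine IsConstructible.iUnion fun i => ?_
    exact hWc _ _ G n
  have hpos : ∀ i, 0 < (![r, q] : Fin 2 → ℕ) i := hlex.2.1
  -- Chevalley
  have hfin := finite_image_comap_of_isConstructible (algebraMap A (extReesAlgebra (weightedMonomialIdeal U ![r, q])))
    hF P hmax hW ?_ ?_
  rotate_left
  · -- (WP)
    rintro 𝔫 h𝔫
    obtain ⟨i, hT, -, -⟩ := Set.mem_iUnion.mp h𝔫
    exact hVU _ inferInstance (hWP 𝔫.asIdeal hT)
  · -- (Wη)
    rintro 𝔫 h𝔫 hcomap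
    obtain ⟨i, hT, hXi, hmem⟩ := Set.mem_iUnion.mp h𝔫
    have hV : ¬ extReesAlgebra.vertexIdeal (weightedMonomialIdeal U ![r, q]) ≤ 𝔫.asIdeal :=
      fun hle => hXi (hle (uT_mem_vertexIdeal U ![r, q] (hpos i)))
    exact not_mem_pow_of_over_generic P hdimP hn hord U hlex rfl hfg hG hcontr 𝔫 hT hV hcomap hmem
  -- (Wtie): every tie prime is in the image
  refine hfin.subset ?_
  rintro 𝔮 ⟨hP𝔮, hreg, hP₀, hu, hli, htie, hfn, hfn', htop⟩
  haveI := hreg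
  haveI := hP₀
  have hcomapP : (P.map (algebraMap A (Localization.AtPrime 𝔮.asIdeal))).comap (algebraMap A _) = P := by
    have h := IsLocalization.under_map_of_isPrime_disjoint 𝔮.asIdeal.primeCompl (Localization.AtPrime 𝔮.asIdeal)
      (I := P) inferInstance (Set.disjoint_left.mpr fun a ha haP => ha (hP𝔮.le haP))
    rwa [Ideal.under_def] at h
  have hlex' := isLexMax_localization_localization 𝔮.asIdeal (P.map (algebraMap A (Localization.AtPrime 𝔮.asIdeal))) P
    hcomapP hlex
  have huP : ∀ i, algebraMap A (Localization.AtPrime 𝔮.asIdeal) (U i) ∈ P.map (algebraMap A (Localization.AtPrime 𝔮.asIdeal)) :=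
    fun i => Ideal.mem_map_of_mem _ (hUP i)
  obtain ⟨𝔫, hT, hV, hcomap, hmem⟩ := exists_noDrop_prime_of_isTiePosition 𝔮.asIdeal htie hfn hfn'
    (P.map (algebraMap A (Localization.AtPrime 𝔮.asIdeal))) htop U hu hli huP hlex' hfg
  obtain ⟨i, hi⟩ := LocalGameEFTPointMove.exists_uT_not_mem U ![r, q] hV
  refine ⟨𝔫, Set.mem_iUnion.mpr ⟨i, hT, hi, hmem⟩, ?_⟩
  exact PrimeSpectrum.ext hcomap

end TieFinite

end Summit.ResolutionOfSingularities.ResolutionOfSingularities.Cruxes.HypersurfaceCentreConstruction.LocalEngine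

end
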